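import Mathlib.Analysis.SpecialFunctions.Trigonometric.DerivHyp
import Literature.Analysis.ODE.SchrodingerSturm
import Literature.Analysis.ODE.ComplexOverRealBasis
import HarnessLib

/-!
# The monotone real basis of `y″ = q y` on a forbidden interval (`q ≥ 0`) and the cosh comparison

Topic `Literature/Analysis/ODE` (namespace `Literature.Analysis.ODE`), continuing
`SchrodingerODE.lean` / `SchrodingerSturm.lean`. On an interval `[α, β]` where the continuous
coefficient of the real equation `y″ = q(x) y` is nonnegative (a classically forbidden region of a
one-dimensional Schrödinger equation, `q = V − E ≥ 0`), the two solutions normalised at the two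
ends,
`g(α) = 1, g′(α) = 0` and `d(β) = 1, d′(β) = 0`,
form the natural real fundamental pair: `g ≥ 1` is non-decreasing and convex, `d ≥ 1` is
non-increasing, their Wronskian is the constant `g d′ − g′ d = −g′(β) = d′(α)`, and when
`q ≥ k² > 0` they dominate the constant-coefficient solutions,
`g(x) ≥ cosh k(x − α)`, `g′(x) ≥ k sinh k(x − α)`, `d(x) ≥ cosh k(β − x)`, `−d′(x) ≥ k sinh k(β − x)`
(Sturm comparison with `y″ = k² y`; this is the quantitative tunnelling input "the growing
component cannot cancel" consumed by `ComplexOverRealBasis.lean`). Everything is proved: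

* `le_of_minorant_sol` — **Sturm comparison over a positive minorant**: if `u″ = q u`, `u ≥ 0`,
  and `C > 0` solves `C″ = c C` with `c ≤ q`, `C′ ≥ 0` on `[s₀, T]`, `C(s₀) ≤ u(s₀)` and the
  Wronskian `u′C − uC′` is `≥ 0` at `s₀`, then `C ≤ u` and `C′ ≤ u′` on `[s₀, T]` (the Wronskian has
  derivative `(q − c) u C ≥ 0`, so `u / C` is non-decreasing);
* `IsSchrodingerSol.one_le_of_nonneg_coeff` (`…_left`), `antitoneOn_of_nonneg_coeff_left` — the
  solution with data `(1, 0)` at the left (right) end of an interval where `q ≥ 0` satisfies `u ≥ 1`,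
  `u′ ≥ 0` (`u′ ≤ 0`) there (from the positivity propagation of `SchrodingerSturm.lean`);
* `IsSchrodingerSol.cosh_le_of_sq_le_coeff` (`…_left`) — the cosh / sinh lower bounds when
  `q ≥ k²`;
* `exists_barrierBasis` — the packaged statement: existence of `g, g′, d, d′ : ℝ → ℝ` with all of
  the above on `[α, β]`, in the pointwise `HasDerivAt` form consumed by
  `ComplexOverRealBasis.eq_data_mul_add` / `flux_floor_of_data`.

## References

* P. Hartman, *Ordinary Differential Equations*, Classics in Applied Mathematics 38 (SIAM 2002),
  Ch. XI §3 (Sturm comparison), §6 (disconjugacy, principal solutions; Cor. 6.4 and its proof: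
  convexity of positive solutions when `q ≥ 0`). Key `Hartman2002`.
* F. W. J. Olver, *Asymptotics and Special Functions* (Academic Press 1974), Ch. 6 §§1–2
  (exponential-type solutions in intervals free of turning points). Key `Olver1974`.
-/

noncomputable section

open Set Filter
open scoped _root_.Topology

namespace Literature.Analysis.ODE

/-! ## Sturm comparison over a positive minorant -/

/-- **Sturm comparison over a positive minorant solution.** On `[s₀, T]` let `u″ = q u` with
`u ≥ 0`, and let `C > 0` satisfy `C″ = c C` with `c ≤ q` and `C′ ≥ 0`. If `C s₀ ≤ u s₀` and the
Wronskian `u′ C − u C′` is nonnegative at `s₀`, then `C ≤ u` and `C′ ≤ u′` on `[s₀, T]`: the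
Wronskian has derivative `(q − c) u C ≥ 0`, hence stays `≥ 0`, so `u / C` is non-decreasing, and
finally `u′ C ≥ u C′ ≥ C C′`. [folklore] -/
theorem le_of_minorant_sol {u u' C C' q : ℝ → ℝ} {c s₀ T : ℝ}
    (hu : ∀ s ∈ Icc s₀ T, HasDerivAt u (u' s) s ∧ HasDerivAt u' (q s * u s) s)
    (hC : ∀ s ∈ Icc s₀ T, HasDerivAt C (C' s) s ∧ HasDerivAt C' (c * C s) s)
    (hqc : ∀ s ∈ Icc s₀ T, c ≤ q s) (hu0 : ∀ s ∈ Icc s₀ T, 0 ≤ u s)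
    (hC0 : ∀ s ∈ Icc s₀ T, 0 < C s) (hC'0 : ∀ s ∈ Icc s₀ T, 0 ≤ C' s)
    (h0 : C s₀ ≤ u s₀) (h1 : u s₀ * C' s₀ ≤ u' s₀ * C s₀) :
    ∀ s ∈ Icc s₀ T, C s ≤ u s ∧ C' s ≤ u' s := by
  -- the Wronskian `Φ = u′ C − u C′` is non-decreasing
  have hΦ : ∀ s ∈ Icc s₀ T, HasDerivAt (fun s => u' s * C s - u s * C' s)
      ((q s - c) * u s * C s) s := fun s hs =>
    (((hu s hs).2.mul (hC s hs).1).sub ((hu s hs).1.mul (hC s hs).2)).congr_deriv (by ring)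
  have hΦmono : MonotoneOn (fun s => u' s * C s - u s * C' s) (Icc s₀ T) :=
    monotoneOn_of_deriv_nonneg (convex_Icc s₀ T)
      (fun s hs => (hΦ s hs).continuousAt.continuousWithinAt)
      (fun s hs => (hΦ s (interior_subset hs)).differentiableAt.differentiableWithinAt)
      fun s hs => by
        have hs' : s ∈ Icc s₀ T := interior_subset hs
        rw [(hΦ s hs').deriv]
        exact mul_nonneg (mul_nonneg (sub_nonneg.2 (hqc s hs')) (hu0 s hs')) (hC0 s hs').le
  have hΦ0 : ∀ s ∈ Icc s₀ T, u s * C' s ≤ u' s * C s := fun s hs => by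
    have h : u' s₀ * C s₀ - u s₀ * C' s₀ ≤ u' s * C s - u s * C' s :=
      hΦmono (left_mem_Icc.2 (hs.1.trans hs.2)) hs hs.1
    linarith
  -- hence `u / C` is non-decreasing
  have hR : ∀ s ∈ Icc s₀ T, HasDerivAt (fun s => u s / C s)
      ((u' s * C s - u s * C' s) / C s ^ 2) s := fun s hs =>
    (hu s hs).1.div (hC s hs).1 (hC0 s hs).ne'
  have hRmono : MonotoneOn (fun s => u s / C s) (Icc s₀ T) :=
    monotoneOn_of_deriv_nonneg (convex_Icc s₀ T)
      (fun s hs => (hR s hs).continuousAt.continuousWithinAt)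
      (fun s hs => (hR s (interior_subset hs)).differentiableAt.differentiableWithinAt)
      fun s hs => by
        have hs' : s ∈ Icc s₀ T := interior_subset hs
        rw [(hR s hs').deriv]
        exact div_nonneg (sub_nonneg.2 (hΦ0 s hs')) (sq_nonneg _)
  intro s hs
  have hs₀ : s₀ ∈ Icc s₀ T := left_mem_Icc.2 (hs.1.trans hs.2)
  have hCs : 0 < C s := hC0 s hs
  have hle : C s ≤ u s := by
    have h : u s₀ / C s₀ ≤ u s / C s := hRmono hs₀ hs hs.1
    have h1' : 1 ≤ u s₀ / C s₀ := by
      rw [le_div_iff₀ (hC0 s₀ hs₀), one_mul]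
      exact h0
    have h2 := h1'.trans h
    rwa [le_div_iff₀ hCs, one_mul] at h2
  refine ⟨hle, ?_⟩
  -- `C′ C ≤ C′ u = u C′ ≤ u′ C`
  have h2 : C' s * C s ≤ u' s * C s :=
    calc C' s * C s ≤ C' s * u s := mul_le_mul_of_nonneg_left hle (hC'0 s hs)
      _ = u s * C' s := mul_comm _ _
      _ ≤ u' s * C s := hΦ0 s hs
  exact le_of_mul_le_mul_right h2 hCs

/-! ## The comparison functions `cosh k(s − s₀)`, `k sinh k(s − s₀)` -/

/-- `(cosh k(s − s₀))′ = k sinh k(s − s₀)`. [folklore] -/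
theorem hasDerivAt_cosh_mul_sub (k s₀ s : ℝ) :
    HasDerivAt (fun s => Real.cosh (k * (s - s₀))) (k * Real.sinh (k * (s - s₀))) s :=
  (((hasDerivAt_id' s).sub_const s₀).const_mul k).cosh.congr_deriv (by ring)

/-- `(k sinh k(s − s₀))′ = k² cosh k(s − s₀)`. [folklore] -/
theorem hasDerivAt_sinh_mul_sub (k s₀ s : ℝ) :
    HasDerivAt (fun s => k * Real.sinh (k * (s - s₀))) (k ^ 2 * Real.cosh (k * (s - s₀))) s :=
  ((((hasDerivAt_id' s).sub_const s₀).const_mul k).sinh.const_mul k).congr_deriv (by ring)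

namespace IsSchrodingerSol

variable {q u : ℝ → ℝ}

/-! ## The end-normalised solutions on a forbidden interval -/

/-- **The left-normalised solution is a barrier.** If `q ≥ 0` on `[s₀, T]` and `u s₀ = 1`,
`u′ s₀ = 0`, then `u ≥ 1` and `u′ ≥ 0` on `[s₀, T]` (positivity propagation and convexity,
Hartman Ch. XI, proof of Cor. 6.4). [cite: Hartman2002, Ch. XI Cor. 6.4 (proof)] -/
theorem one_le_of_nonneg_coeff (hu : IsSchrodingerSol q u) {s₀ T : ℝ}
    (hq0 : ∀ s ∈ Icc s₀ T, 0 ≤ q s) (h0 : u s₀ = 1) (h1 : deriv u s₀ = 0) :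
    ∀ s ∈ Icc s₀ T, 1 ≤ u s ∧ 0 ≤ deriv u s := fun s hs => by
  have hpos : 0 < u s₀ := by rw [h0]; exact one_pos
  refine ⟨?_, h1 ▸ hu.deriv_le_deriv_of_nonneg_coeff hq0 hpos h1.ge s hs⟩
  rw [← h0]
  exact hu.monotoneOn_of_nonneg_coeff hq0 hpos h1.ge (left_mem_Icc.2 (hs.1.trans hs.2)) hs hs.1

/-- Backward in time: if `q ≥ 0` on `[T, s₀]`, `u s₀ > 0` and `u′ s₀ ≤ 0`, then `u` is
non-increasing on `[T, s₀]` (mirror image of `monotoneOn_of_nonneg_coeff`). [folklore] -/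
theorem antitoneOn_of_nonneg_coeff_left (hu : IsSchrodingerSol q u) {T s₀ : ℝ}
    (hq0 : ∀ s ∈ Icc T s₀, 0 ≤ q s) (h0 : 0 < u s₀) (h1 : deriv u s₀ ≤ 0) :
    AntitoneOn u (Icc T s₀) :=
  antitoneOn_of_deriv_nonpos (convex_Icc T s₀) hu.continuous.continuousOn
    hu.differentiable.differentiableOn fun s hs => by
      rw [interior_Icc] at hs
      exact (hu.deriv_le_deriv_of_nonneg_coeff_left hq0 h0 h1 s (Ioo_subset_Icc_self hs)).trans h1

/-- **The right-normalised solution is a barrier.** If `q ≥ 0` on `[T, s₀]` and `u s₀ = 1`,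
`u′ s₀ = 0`, then `u ≥ 1` and `u′ ≤ 0` on `[T, s₀]`. [folklore] -/
theorem one_le_of_nonneg_coeff_left (hu : IsSchrodingerSol q u) {T s₀ : ℝ}
    (hq0 : ∀ s ∈ Icc T s₀, 0 ≤ q s) (h0 : u s₀ = 1) (h1 : deriv u s₀ = 0) :
    ∀ s ∈ Icc T s₀, 1 ≤ u s ∧ deriv u s ≤ 0 := fun s hs => by
  have hpos : 0 < u s₀ := by rw [h0]; exact one_pos
  refine ⟨?_, h1 ▸ hu.deriv_le_deriv_of_nonneg_coeff_left hq0 hpos h1.le s hs⟩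
  rw [← h0]
  exact hu.antitoneOn_of_nonneg_coeff_left hq0 hpos h1.le hs (right_mem_Icc.2 (hs.1.trans hs.2))
    hs.2

/-! ## The cosh comparison (`q ≥ k²`) -/

/-- **Cosh lower bound, forward.** If `q ≥ k²` (`k ≥ 0`) on `[s₀, T]` and `u s₀ = 1`, `u′ s₀ = 0`,
then `cosh k(s − s₀) ≤ u s` and `k sinh k(s − s₀) ≤ u′ s` for `s ∈ [s₀, T]` (Sturm comparison with
the solution `cosh k(s − s₀)` of `y″ = k² y` with the same data). [cite: Hartman2002, Ch. XI §6] -/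
theorem cosh_le_of_sq_le_coeff (hu : IsSchrodingerSol q u) {s₀ T k : ℝ} (hk : 0 ≤ k)
    (hqk : ∀ s ∈ Icc s₀ T, k ^ 2 ≤ q s) (h0 : u s₀ = 1) (h1 : deriv u s₀ = 0) :
    ∀ s ∈ Icc s₀ T, Real.cosh (k * (s - s₀)) ≤ u s ∧
      k * Real.sinh (k * (s - s₀)) ≤ deriv u s := by
  have hq0 : ∀ s ∈ Icc s₀ T, 0 ≤ q s := fun s hs => (sq_nonneg k).trans (hqk s hs)
  have hpos : ∀ s ∈ Icc s₀ T, 0 < u s :=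
    hu.pos_of_nonneg_coeff hq0 (by rw [h0]; exact one_pos) h1.ge
  refine le_of_minorant_sol (u' := deriv u) (C := fun s => Real.cosh (k * (s - s₀)))
    (C' := fun s => k * Real.sinh (k * (s - s₀))) (c := k ^ 2)
    (fun s _ => ⟨hu.hasDerivAt s, hu.hasDerivAt_deriv s⟩)
    (fun s _ => ⟨hasDerivAt_cosh_mul_sub k s₀ s, hasDerivAt_sinh_mul_sub k s₀ s⟩)
    hqk (fun s hs => (hpos s hs).le) (fun s _ => Real.cosh_pos _)
    (fun s hs => mul_nonneg hk (Real.sinh_nonneg_iff.2 (mul_nonneg hk (sub_nonneg.2 hs.1))))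
    ?_ ?_
  · simp [h0]
  · simp [h0, h1]

/-- **Cosh lower bound, backward.** If `q ≥ k²` (`k ≥ 0`) on `[T, s₀]` and `u s₀ = 1`,
`u′ s₀ = 0`, then `cosh k(s₀ − s) ≤ u s` and `k sinh k(s₀ − s) ≤ −u′ s` for `s ∈ [T, s₀]`
(time reversal of `cosh_le_of_sq_le_coeff`). [folklore] -/
theorem cosh_le_of_sq_le_coeff_left (hu : IsSchrodingerSol q u) {T s₀ k : ℝ} (hk : 0 ≤ k)
    (hqk : ∀ s ∈ Icc T s₀, k ^ 2 ≤ q s) (h0 : u s₀ = 1) (h1 : deriv u s₀ = 0) :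
    ∀ s ∈ Icc T s₀, Real.cosh (k * (s₀ - s)) ≤ u s ∧
      k * Real.sinh (k * (s₀ - s)) ≤ -deriv u s := by
  intro s hs
  have h := hu.comp_neg.cosh_le_of_sq_le_coeff (s₀ := -s₀) (T := -T) hk
    (fun τ hτ => hqk (-τ) ⟨by linarith [hτ.2], by linarith [hτ.1]⟩) (by simp [h0])
    (by rw [hu.deriv_comp_neg, neg_neg, h1, neg_zero]) (-s) ⟨by linarith [hs.2], by linarith [hs.1]⟩
  rw [hu.deriv_comp_neg, neg_neg, show -s - -s₀ = s₀ - s by ring] at h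
  exact h

end IsSchrodingerSol

/-! ## The barrier basis -/

/-- **The monotone real basis on a forbidden interval, with cosh comparison.** Let `q` be
continuous with `q ≥ 0` on `[α, β]`. Then there are global classical solutions `g, d` of
`y″ = q y` (with derivatives `g′, d′`, all four in pointwise `HasDerivAt` form on `ℝ`) normalised by
`g(α) = 1, g′(α) = 0`, `d(β) = 1, d′(β) = 0`, such that on `[α, β]`: `g ≥ 1`, `g′ ≥ 0`, `d ≥ 1`,
`d′ ≤ 0`, `g` is non-decreasing and `d` non-increasing; the Wronskian is the constant
`g d′ − g′ d = −g′(β) = d′(α)`; and whenever `q ≥ k²` on `[α, β]` with `k > 0`,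
`cosh k(x − α) ≤ g x`, `k sinh k(x − α) ≤ g′ x`, `cosh k(β − x) ≤ d x`, `k sinh k(β − x) ≤ −d′ x`
("the equation is disconjugate and its positive solutions are convex", Hartman Ch. XI §6, with the
Sturm comparison against `y″ = k² y`). [cite: Hartman2002, Ch. XI §6] -/
theorem exists_barrierBasis {q : ℝ → ℝ} (hq : Continuous q) {α β : ℝ} (hαβ : α ≤ β)
    (hq0 : ∀ x ∈ Icc α β, 0 ≤ q x) :
    ∃ g g' d d' : ℝ → ℝ,
      (∀ x, HasDerivAt g (g' x) x ∧ HasDerivAt g' (q x * g x) x) ∧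
      (∀ x, HasDerivAt d (d' x) x ∧ HasDerivAt d' (q x * d x) x) ∧
      g α = 1 ∧ g' α = 0 ∧ d β = 1 ∧ d' β = 0 ∧
      (∀ x ∈ Icc α β, 1 ≤ g x ∧ 0 ≤ g' x ∧ 1 ≤ d x ∧ d' x ≤ 0) ∧
      MonotoneOn g (Icc α β) ∧ AntitoneOn d (Icc α β) ∧
      (∀ x ∈ Icc α β, g x * d' x - g' x * d x = -g' β) ∧ d' α = -g' β ∧
      ∀ k : ℝ, 0 < k → (∀ x ∈ Icc α β, k ^ 2 ≤ q x) →
        (∀ x ∈ Icc α β, Real.cosh (k * (x - α)) ≤ g x ∧ k * Real.sinh (k * (x - α)) ≤ g' x ∧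
          Real.cosh (k * (β - x)) ≤ d x ∧ k * Real.sinh (k * (β - x)) ≤ -d' x) := by
  obtain ⟨g, hg, hg0, hg1⟩ := exists_isSchrodingerSol hq α 1 0
  obtain ⟨d, hd, hd0, hd1⟩ := exists_isSchrodingerSol hq β 1 0
  have hG : ∀ x, HasDerivAt g (deriv g x) x ∧ HasDerivAt (deriv g) (q x * g x) x :=
    fun x => ⟨hg.hasDerivAt x, hg.hasDerivAt_deriv x⟩
  have hD : ∀ x, HasDerivAt d (deriv d x) x ∧ HasDerivAt (deriv d) (q x * d x) x :=
    fun x => ⟨hd.hasDerivAt x, hd.hasDerivAt_deriv x⟩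
  have hgb := hg.one_le_of_nonneg_coeff hq0 hg0 hg1
  have hdb := hd.one_le_of_nonneg_coeff_left hq0 hd0 hd1
  have hgpos : 0 < g α := by rw [hg0]; exact one_pos
  have hdpos : 0 < d β := by rw [hd0]; exact one_pos
  -- the Wronskian, evaluated at `α` and at `β`
  have hW : ∀ x ∈ Icc α β, g x * deriv d x - d x * deriv g x = deriv d α := by
    intro x hx
    rw [wronskian_real_const (fun y _ => hG y) (fun y _ => hD y) hx, hg0, hg1, one_mul, mul_zero,
      sub_zero]
  have hWβ : deriv d α = -deriv g β := by
    have h := hW β (right_mem_Icc.2 hαβ)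
    rw [hd0, hd1, mul_zero, one_mul, zero_sub] at h
    exact h.symm
  refine ⟨g, deriv g, d, deriv d, hG, hD, hg0, hg1, hd0, hd1,
    fun x hx => ⟨(hgb x hx).1, (hgb x hx).2, (hdb x hx).1, (hdb x hx).2⟩,
    hg.monotoneOn_of_nonneg_coeff hq0 hgpos hg1.ge,
    hd.antitoneOn_of_nonneg_coeff_left hq0 hdpos hd1.le,
    fun x hx => ?_, hWβ, fun k hk hqk x hx => ?_⟩
  · rw [← hWβ, ← hW x hx]
    ring
  · have h1 := hg.cosh_le_of_sq_le_coeff hk.le hqk hg0 hg1 x hx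
    have h2 := hd.cosh_le_of_sq_le_coeff_left hk.le hqk hd0 hd1 x hx
    exact ⟨h1.1, h1.2, h2.1, h2.2⟩

end Literature.Analysis.ODE
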